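import Literature.NumberTheory.Transcendental.RoySmallValueLevelHeights
import Literature.NumberTheory.Transcendental.RoySmallValueMultiplicity
import Literature.NumberTheory.Transcendental.RoySmallValueZeros
import HarnessLib

/-!
# Roy's small value estimate for `𝔾ₐ × 𝔾ₘ` — Proposition 6.5 for a level package (degree and height of a cycle in `𝒵(𝒟ⁱP̃ ; i < 2T)`)

Topic `Literature/NumberTheory/Transcendental`. Part of the formalisation of the proof of Roy 2013,
Theorem 1.1 (named fact `roy2013_thm_1_1`, `RoySmallValueEstimates.lean`), seat B. Source: D. Roy,
*A small value estimate for `𝔾ₐ × 𝔾ₘ`*, Mathematika 59 (2013) 333–363 = arXiv:1301.0663, §6,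
Proposition 6.5 and its proof (p. 17), used in §7, Step 3 (p. 19):

> **Proposition 6.5.** Let `P ∈ ℤ[X]_D` not divisible by `X₀` nor `X₂`, `T ≤ binom(D+1,2)` [...]
> and let `Z` be a zero-dimensional subvariety of `ℙ²_ℚ` contained in `𝒵(𝒟ⁱP ; 0 ≤ i < 2T)`. Then
> `deg(Z) ≤ D²/T` and `h(Z) ≤ (…)/T`. *Proof.* [...] each `α ∈ Z(ℂ)` [...] `P, Q ∈ I_D^{(α,T)}`
> [...] `e_α ≥ T` [...] `T deg(Z) ≤ ∑ e_i = D²` [...]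
> (Step 3) `deg(Z) ≤ (D*+1)²/⌊(D*+1)^τ⌋`, `h(Z) ≤ 6(D*+1)^{1+β}/⌊(D*+1)^τ⌋`.

For a level package `L : LevelPkg D P̃` (parallel seat's `RoySmallValueLevels`) and a set `S` of its
points lying in the chart `α₀α₂ ≠ 0` at which `𝒟ᵏP̃` vanishes for all `k < T + D` (so that `P̃` and
the companion `Q = ∑_{i≤D} tⁱ𝒟ⁱP̃` lie in `I^{(α,T)}`, `levelQ_mem_vanIdeal`), the exact
multiplicity bound `T ≤ e_i` (`RoySmallValueMultiplicity.le_mult_of_mem_vanIdeal`) gives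

* `mul_card_le_sq` — `T · #S ≤ D²` (Roy's `deg(Z) ≤ D²/T`);
* `mul_sum_height_le` — `T · D · ∑_{i∈S} h_K(rep i) ≤ [K:ℚ] · log 𝓛(Φ(P̃, Q, ·))`
  (with `RoySmallValueLevelHeights.sum_e_mul_height_le`; Roy's `h(Z) ≤ …/T`).

Everything is proved; no definitions, no named facts.

## References

* [Roy2013] D. Roy, *A small value estimate for 𝔾ₐ × 𝔾ₘ*, Mathematika 59 (2013), 333–363
  (arXiv:1301.0663), Proposition 6.5 and §7, Step 3.
-/

noncomputable section

open MvPolynomial Finset Height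

namespace Literature.NumberTheory.Transcendental

namespace Roy2013

/-! ### Vanishing of `P̃`, `Q` to order `T` -/

/-- If `𝒟ᵏF(α) = 0` for all `k < T + D` then `F` and `Q = ∑_{1≤i≤D} tⁱ𝒟ⁱF` vanish to order `T` at
`α` (chart `α₀ ≠ 0`). [cite: Roy2013, §6, proof of Prop. 6.5 ("`P, Q ∈ I_D^{(α,T)}`")] -/
theorem levelQ_mem_vanIdeal {D : ℕ} {Pt : MvPolynomial (Fin 3) ℤ}
    (hPt : (map (Int.castRingHom ℂ) Pt).IsHomogeneous D) (t : ℕ) {T : ℕ} {α : Fin 3 → ℂ}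
    (hα : α 0 ≠ 0) (hvan : ∀ k < T + D, eval α (homD^[k] (map (Int.castRingHom ℂ) Pt)) = 0) :
    map (Int.castRingHom ℂ) Pt ∈ vanIdeal (α 1 / α 0) (α 2 / α 0) T ∧
      map (Int.castRingHom ℂ) (levelQ D Pt t) ∈ vanIdeal (α 1 / α 0) (α 2 / α 0) T := by
  constructor
  · rw [mem_vanIdeal_iff_of_ne_zero hPt hα]
    exact fun i hi => hvan i (by omega)
  · rw [mem_vanIdeal_iff_of_ne_zero (isHomogeneous_map_levelQ hPt t) hα]
    intro j hj
    rw [map_levelQ, iterate_homD_sum, map_sum]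
    refine Finset.sum_eq_zero fun i hi => ?_
    rw [iterate_homD_smul, smul_eq_C_mul, map_mul, ← Function.iterate_add_apply, hvan _ (by
      have := (mem_Icc.mp hi).2; omega), mul_zero]

namespace LevelPkg

variable {D : ℕ} {Pt : MvPolynomial (Fin 3) ℤ} (L : LevelPkg D Pt)

/-- **`T ≤ e_i`** at a point of the package in the chart `α₀α₂ ≠ 0` where `𝒟ᵏP̃` vanishes for
`k < T + D`. [cite: Roy2013, §6, proof of Prop. 6.5 (`e_α ≥ T`, via Cor. 5.7 / Prop. 3.6)] -/
theorem le_e_of_vanishing (hPt : (map (Int.castRingHom ℂ) Pt).IsHomogeneous D) {Li T : ℕ}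
    (hT₁ : (Li + 1).choose 2 < T) (hT₂ : T ≤ (Li + 2).choose 2) (hLD : Li < D) {i : Fin L.m}
    (h0 : L.α i 0 ≠ 0) (h2 : L.α i 2 ≠ 0)
    (hvan : ∀ k < T + D, eval (L.α i) (homD^[k] (map (Int.castRingHom ℂ) Pt)) = 0) :
    T ≤ L.e i := by
  obtain ⟨hPv, hQv⟩ := levelQ_mem_vanIdeal hPt L.t h0 hvan
  exact le_mult_of_mem_vanIdeal hPt (isHomogeneous_map_levelQ hPt L.t) L.hM₁ L.hM₂ L.σ
    L.α_ne_zero L.sep L.hc L.hFeq hT₁ hT₂ hLD h0 h2 hPv hQv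

/-- **Roy 2013, Prop. 6.5, degree part**: `T · #S ≤ D²` for a set `S` of points of
`𝒵(P̃, Q)` (chart `α₀α₂ ≠ 0`) at which `𝒟ᵏP̃` vanishes for `k < T + D`.
[cite: Roy2013, Proposition 6.5 (`deg(Z) ≤ D²/T`)] -/
theorem mul_card_le_sq (hPt : (map (Int.castRingHom ℂ) Pt).IsHomogeneous D) {Li T : ℕ}
    (hT₁ : (Li + 1).choose 2 < T) (hT₂ : T ≤ (Li + 2).choose 2) (hLD : Li < D)
    (S : Finset (Fin L.m)) (h0 : ∀ i ∈ S, L.α i 0 ≠ 0) (h2 : ∀ i ∈ S, L.α i 2 ≠ 0)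
    (hvan : ∀ i ∈ S, ∀ k < T + D, eval (L.α i) (homD^[k] (map (Int.castRingHom ℂ) Pt)) = 0) :
    T * S.card ≤ D ^ 2 := by
  calc T * S.card = ∑ _i ∈ S, T := by rw [sum_const, smul_eq_mul, mul_comm]
    _ ≤ ∑ i ∈ S, L.e i := sum_le_sum fun i hi =>
        L.le_e_of_vanishing hPt hT₁ hT₂ hLD (h0 i hi) (h2 i hi) (hvan i hi)
    _ ≤ ∑ i, L.e i := sum_le_sum_of_subset_of_nonneg (subset_univ S) fun _ _ _ => Nat.zero_le _
    _ = D ^ 2 := by rw [L.hesum, L.hcard]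

/-- **Roy 2013, Prop. 6.5, height part**: `T · D · ∑_{i∈S} h_K(rep i) ≤ [K:ℚ] · log 𝓛(F₀)` for such
a set `S`, `F₀ = Φ(P̃, Q, ·) ∈ ℤ[r]`. [cite: Roy2013, Proposition 6.5 (`h(Z) ≤ …/T`) and §7 Step 3] -/
theorem mul_sum_height_le (hPt : (map (Int.castRingHom ℂ) Pt).IsHomogeneous D) {Li T : ℕ}
    (hT₁ : (Li + 1).choose 2 < T) (hT₂ : T ≤ (Li + 2).choose 2) (hLD : Li < D)
    (K : IntermediateField ℚ ℂ) (hK : ∀ i k, L.α i k ∈ K) [NumberField K]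
    (S : Finset (Fin L.m)) (h0 : ∀ i ∈ S, L.α i 0 ≠ 0) (h2 : ∀ i ∈ S, L.α i 2 ≠ 0)
    (hvan : ∀ i ∈ S, ∀ k < T + D, eval (L.α i) (homD^[k] (map (Int.castRingHom ℂ) Pt)) = 0) :
    T * (D * ∑ i ∈ S, logHeight ((L.cfg K hK).rep i)) ≤
      Module.finrank ℚ K * Real.log (∑ m ∈ L.intF.support, |((coeff m L.intF : ℤ) : ℝ)|) := by
  have hmain := L.sum_e_mul_height_le K hK
  have hnn : ∀ i, 0 ≤ (D : ℝ) * logHeight ((L.cfg K hK).rep i) := fun i =>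
    mul_nonneg (Nat.cast_nonneg _) (logHeight_nonneg _)
  calc (T : ℝ) * (D * ∑ i ∈ S, logHeight ((L.cfg K hK).rep i))
      = ∑ i ∈ S, (T : ℝ) * (D * logHeight ((L.cfg K hK).rep i)) := by
        rw [mul_sum, mul_sum]
    _ ≤ ∑ i ∈ S, (L.e i : ℝ) * (D * logHeight ((L.cfg K hK).rep i)) := by
        refine sum_le_sum fun i hi => mul_le_mul_of_nonneg_right ?_ (hnn i)
        exact_mod_cast L.le_e_of_vanishing hPt hT₁ hT₂ hLD (h0 i hi) (h2 i hi) (hvan i hi)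
    _ ≤ ∑ i, (L.e i : ℝ) * (D * logHeight ((L.cfg K hK).rep i)) :=
        sum_le_sum_of_subset_of_nonneg (subset_univ S) fun i _ _ =>
          mul_nonneg (Nat.cast_nonneg _) (hnn i)
    _ ≤ _ := hmain

end LevelPkg

end Roy2013

end Literature.NumberTheory.Transcendental
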